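import Literature.MathematicalPhysics.QuantumFieldTheory.Balaban1983to89.Setup

/-!
# T⁴ programme, SUBSTRATE — `Support/SubstrateLargeField`: the LARGE∕SMALL-FIELD DECOMPOSITION OF RECORD in the
# vocabulary of record (V1 = `Setup`): inclusion–exclusion over plaquettes turns a density `ρ` and a family of plaquette
# cut-offs `χ_p ∈ [0,1]` into a `Setup.LargeFieldDecomp` whose total IS `ρ`; the sharp cut-off of record `chiPlaq δ` and
# its product `= Setup.chiSmall`; with sharp cut-offs the piece of region `Z` is `ρ · 𝟙[Z = the large-field set of V]`

Audit cell `pub-balaban`, SUBSTRATE cell (coordinator 2026-08-20), seat p4, map item **S-LF** of `substrate/SUBSTRATE-MAP.md`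
§2 (typer sketch `substrate/typer/SubstrateSketch.v0.1.lean` §D3: `lfPiece`, `LfTotal_stmt`, `LfNonneg_stmt`, `lfDecompOfRecord`,
`chiPlaq`, `ChiProd_stmt` — landed here with the sketch's names; the statements `…_stmt` become the theorems `lfPiece_total`,
`lfPiece_nonneg`, `prod_chiPlaq`).

WHAT IS PRINTED (documentation of what the objects read; nothing printed is asserted).  [Balaban1989LargeFieldI] (T. Bałaban,
*Large field renormalization. I*, Commun. Math. Phys. **122** (1989) 175–202) (0.2)–(0.6) p. 176: the density after `k` steps is
a sum over large-field regions `ρ_k = Σ_Z ρ_k(Z)`, produced by expanding products of characteristic functions of small-field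
conditions and their complements; [Balaban1988Convergent] (1.1) p. 246: *"1 = Σ_{P₀} Π_{□ ⊂ P₀ᶜ} χ(…) Π_{□ ⊂ P₀} χ(… ≥ ε₀)"* —
typed for SHARP cube indicators as `B14Sect1Sets.decompUnity` (in tree).  The tree's letters for this bookkeeping are
`Setup.LargeFieldDecomp` (a finite region type, non-negative pieces, `total`), `Setup.chiSmall S δ` / `Setup.PlaqSmallOn` —
with NO instance of `LargeFieldDecomp` anywhere in the tree before this file (typer inventory, MAP §1).

WHAT THIS FILE PROVIDES (all `[folklore]`; general weights `χ_p`, not only indicators):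
 * §1 `lfPiece χ ρ Z V = ρ V · Π_{p ∈ Z}(1 − χ_p V) · Π_{p ∉ Z} χ_p V`; **`lfPiece_total`** `Σ_Z lfPiece χ ρ Z = ρ` (partition of
   unity, `Finset.prod_add` on `Π_p ((1 − χ_p) + χ_p) = 1`); `lfPiece_nonneg` / `lfPiece_le` under `0 ≤ χ ≤ 1`, `0 ≤ ρ`;
   `lfPiece_empty` (the pure small-field piece `Z = ∅` is `ρ · Π_p χ_p`);
 * §2 **`lfDecompOfRecord χ ρ h : Setup.LargeFieldDecomp P j G`** (regions = finite sets of plaquettes) and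
   **`lfDecompOfRecord_total : (lfDecompOfRecord χ ρ h).total = ρ`** — the FIRST inhabitant of the letter with the right total;
 * §3 the sharp cut-off of record `chiPlaq δ p U = 𝟙[dist1 (U(∂p)) < δ]`, its `0/1` algebra, **`prod_chiPlaq`**
   `Π_{p ∈ S} chiPlaq δ p U = Setup.chiSmall ↑S δ U` and `prod_chiPlaq_univ … = chiSmall Set.univ δ U` (mind `chiSmall`'s classical
   `if`), and the EXACT READING of the sharp decomposition: `lfPiece (chiPlaq δ) ρ Z V = if Z = largeSet δ V then ρ V else 0`
   (`lfPiece_chiPlaq`), `largeSet δ V` = the plaquettes with `δ ≤ dist1 (V(∂p))` — so «the sum over Z» selects THE large-field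
   set of the configuration, as in `B14Sect1Sets.decompUnity_term_eq_one_iff` for cubes;
 * §4 measurability: `measurable_chiPlaq` / `measurable_lfPiece` under `[MeasurableSpace G] [MeasurableMul₂ G]
   [MeasurableInv G]` and a measurable `dist1` (displayed hypothesis `hd : Measurable (dist1 : G → ℝ)` — `GaugeGroup` carries no
   topology), so the pieces are densities one can integrate against `Setup.fieldMeasure`.

HONEST FRAMING (T4-DAG p. 1).  Bookkeeping only (finite products and sums of real numbers); no estimate, no smallness, no claim about
Bałaban's seven groups of characteristic functions (B15 (1.3)–(1.9) are reader-owned, `Setup` DIVERGENCE F9) beyond the one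
product shape typed here; the cube-wise (sup over `□̃`) cut-offs of (1.1) are the case `χ_p :=` a cube indicator pulled back to
plaquettes, or directly `B14Sect1Sets.decompUnity`.  NOT an estimate of any NE row; spine 0/9 unchanged; NOT infinite volume,
NOT a mass gap, NOT Clay.  HONEST DEPENDENCY: continuum YM on T⁴ ⇐ BetaPertH ∧ nine spine estimates (0/9 proved); BetaPertH ⇐
(D1) ∧ (D4) ∧ CAP+tail; G-an2-4 gates asym, D1 and NE2/3/4.  No `sorry`.
-/

noncomputable section

open scoped BigOperators
open _root_.MeasureTheory

namespace Summit.QuantumFields.BalabanUV.T4Continuum.SubstrateLargeField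

open Literature.MathematicalPhysics.QuantumFieldTheory.Balaban1983to89

variable {P : Params} {j : ℕ} {G : Type*}

/-! ## §1 The pieces and the partition of unity -/

section Pieces
variable [DecidableEq (Plaq P j)]

/-- The piece of the density `ρ` with large-field set EXACTLY `Z`: `ρ(V) · Π_{p ∈ Z} (1 − χ_p(V)) · Π_{p ∉ Z} χ_p(V)`
(for general weights `χ_p`; the sharp case is §3). [folklore] -/
def lfPiece (χ : Plaq P j → GaugeField P j G → ℝ) (ρ : Density P j G) (Z : Finset (Plaq P j)) : Density P j G :=
  fun V => ρ V * (∏ p ∈ Z, (1 - χ p V)) * ∏ p ∈ Zᶜ, χ p V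

/-- Unfolding lemma. [folklore] -/
theorem lfPiece_apply (χ : Plaq P j → GaugeField P j G → ℝ) (ρ : Density P j G) (Z : Finset (Plaq P j))
    (V : GaugeField P j G) : lfPiece χ ρ Z V = ρ V * (∏ p ∈ Z, (1 - χ p V)) * ∏ p ∈ Zᶜ, χ p V := rfl

/-- **PARTITION OF UNITY**: `Σ_Z lfPiece χ ρ Z V = ρ V` — the expansion of `Π_p ((1 − χ_p) + χ_p) = 1`
(`Finset.prod_add`), for ARBITRARY real weights `χ_p`. [folklore] -/
theorem lfPiece_total (χ : Plaq P j → GaugeField P j G → ℝ) (ρ : Density P j G) (V : GaugeField P j G) :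
    ∑ Z : Finset (Plaq P j), lfPiece χ ρ Z V = ρ V := by
  have h1 : ∏ p : Plaq P j, ((1 - χ p V) + χ p V) = 1 :=
    Finset.prod_eq_one fun p _ => by ring
  have h2 : ∑ Z : Finset (Plaq P j), (∏ p ∈ Z, (1 - χ p V)) * ∏ p ∈ Zᶜ, χ p V = 1 := by
    calc ∑ Z : Finset (Plaq P j), (∏ p ∈ Z, (1 - χ p V)) * ∏ p ∈ Zᶜ, χ p V
        = ∑ Z ∈ (Finset.univ : Finset (Plaq P j)).powerset,
            (∏ p ∈ Z, (1 - χ p V)) * ∏ p ∈ Finset.univ \ Z, χ p V := by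
          rw [Finset.powerset_univ]
          simp only [Finset.compl_eq_univ_sdiff]
      _ = ∏ p : Plaq P j, ((1 - χ p V) + χ p V) := (Finset.prod_add _ _ _).symm
      _ = 1 := h1
  calc ∑ Z : Finset (Plaq P j), lfPiece χ ρ Z V
      = ρ V * ∑ Z : Finset (Plaq P j), (∏ p ∈ Z, (1 - χ p V)) * ∏ p ∈ Zᶜ, χ p V := by
        rw [Finset.mul_sum]
        refine Finset.sum_congr rfl fun Z _ => ?_
        rw [lfPiece_apply, mul_assoc]
    _ = ρ V := by rw [h2, mul_one]

/-- POSITIVITY: `0 ≤ χ_p ≤ 1` and `0 ≤ ρ` give `0 ≤ lfPiece χ ρ Z`. [folklore] -/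
theorem lfPiece_nonneg {χ : Plaq P j → GaugeField P j G → ℝ} {ρ : Density P j G}
    (hχ : ∀ p V, 0 ≤ χ p V ∧ χ p V ≤ 1) (hρ : ∀ V, 0 ≤ ρ V) (Z : Finset (Plaq P j)) (V : GaugeField P j G) :
    0 ≤ lfPiece χ ρ Z V := by
  rw [lfPiece_apply]
  refine mul_nonneg (mul_nonneg (hρ V) (Finset.prod_nonneg fun p _ => ?_)) (Finset.prod_nonneg fun p _ => (hχ p V).1)
  linarith [(hχ p V).2]

/-- Each piece is dominated by the density: `lfPiece χ ρ Z V ≤ ρ V` (all factors in `[0,1]`). [folklore] -/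
theorem lfPiece_le {χ : Plaq P j → GaugeField P j G → ℝ} {ρ : Density P j G}
    (hχ : ∀ p V, 0 ≤ χ p V ∧ χ p V ≤ 1) (hρ : ∀ V, 0 ≤ ρ V) (Z : Finset (Plaq P j)) (V : GaugeField P j G) :
    lfPiece χ ρ Z V ≤ ρ V := by
  rw [lfPiece_apply, mul_assoc]
  refine mul_le_of_le_one_right (hρ V) ?_
  refine mul_le_one₀ (Finset.prod_le_one (fun p _ => ?_) fun p _ => ?_) (Finset.prod_nonneg fun p _ => (hχ p V).1)
    (Finset.prod_le_one (fun p _ => (hχ p V).1) fun p _ => (hχ p V).2)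
  · linarith [(hχ p V).2]
  · linarith [(hχ p V).1]

/-- The pure SMALL-FIELD piece (`Z = ∅`): `ρ · Π_p χ_p`. [folklore] -/
theorem lfPiece_empty (χ : Plaq P j → GaugeField P j G → ℝ) (ρ : Density P j G) (V : GaugeField P j G) :
    lfPiece χ ρ ∅ V = ρ V * ∏ p : Plaq P j, χ p V := by
  rw [lfPiece_apply, Finset.prod_empty, mul_one, Finset.compl_empty]

/-- The pure LARGE-FIELD piece (`Z = univ`): `ρ · Π_p (1 − χ_p)`. [folklore] -/
theorem lfPiece_univ (χ : Plaq P j → GaugeField P j G → ℝ) (ρ : Density P j G) (V : GaugeField P j G) :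
    lfPiece χ ρ Finset.univ V = ρ V * ∏ p : Plaq P j, (1 - χ p V) := by
  rw [lfPiece_apply, Finset.compl_univ, Finset.prod_empty, mul_one]

/-! ## §2 The decomposition of record as `Setup.LargeFieldDecomp` data -/

variable [GaugeGroup G]

/-- **THE LARGE-FIELD DECOMPOSITION OF RECORD** as an inhabitant of the tree's letter `Setup.LargeFieldDecomp`: regions =
finite sets of plaquettes of `T^{(j)}`, pieces = `lfPiece χ ρ`, non-negativity from the displayed witness `h`
(e.g. `lfPiece_nonneg`). [folklore] -/
def lfDecompOfRecord (χ : Plaq P j → GaugeField P j G → ℝ) (ρ : Density P j G) (h : ∀ Z V, 0 ≤ lfPiece χ ρ Z V) :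
    LargeFieldDecomp P j G where
  Region := Finset (Plaq P j)
  piece := lfPiece χ ρ
  nonneg := h

/-- The regions of the decomposition of record are the finite plaquette sets (definitional). [folklore] -/
theorem lfDecompOfRecord_piece (χ : Plaq P j → GaugeField P j G → ℝ) (ρ : Density P j G)
    (h : ∀ Z V, 0 ≤ lfPiece χ ρ Z V) (Z : Finset (Plaq P j)) : (lfDecompOfRecord χ ρ h).piece Z = lfPiece χ ρ Z := rfl

/-- **ITS TOTAL IS THE DENSITY**: `(lfDecompOfRecord χ ρ h).total = ρ` — B15 (0.2) `ρ_k = Σ_Z ρ_k(Z)` holds BY CONSTRUCTION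
for the decomposition of record. [folklore] -/
theorem lfDecompOfRecord_total (χ : Plaq P j → GaugeField P j G → ℝ) (ρ : Density P j G)
    (h : ∀ Z V, 0 ≤ lfPiece χ ρ Z V) : (lfDecompOfRecord χ ρ h).total = ρ := by
  funext V
  exact lfPiece_total χ ρ V

/-- The decomposition of record from the STANDARD positivity witness (`0 ≤ χ ≤ 1`, `0 ≤ ρ`). [folklore] -/
def lfDecompStd (χ : Plaq P j → GaugeField P j G → ℝ) (ρ : Density P j G)
    (hχ : ∀ p V, 0 ≤ χ p V ∧ χ p V ≤ 1) (hρ : ∀ V, 0 ≤ ρ V) : LargeFieldDecomp P j G :=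
  lfDecompOfRecord χ ρ (lfPiece_nonneg hχ hρ)

/-- … with total `ρ`. [folklore] -/
theorem lfDecompStd_total (χ : Plaq P j → GaugeField P j G → ℝ) (ρ : Density P j G)
    (hχ : ∀ p V, 0 ≤ χ p V ∧ χ p V ≤ 1) (hρ : ∀ V, 0 ≤ ρ V) : (lfDecompStd χ ρ hχ hρ).total = ρ :=
  lfDecompOfRecord_total χ ρ _

/-- … and every piece between `0` and `ρ`. [folklore] -/
theorem lfDecompStd_piece_le (χ : Plaq P j → GaugeField P j G → ℝ) (ρ : Density P j G)
    (hχ : ∀ p V, 0 ≤ χ p V ∧ χ p V ≤ 1) (hρ : ∀ V, 0 ≤ ρ V) (Z : Finset (Plaq P j)) (V : GaugeField P j G) :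
    (lfDecompStd χ ρ hχ hρ).piece Z V ≤ ρ V :=
  lfPiece_le hχ hρ Z V

end Pieces

/-! ## §3 The sharp cut-off of record and the exact reading of the sharp decomposition -/

section SharpCutoff
variable [GaugeGroup G]

open Classical in
/-- The SHARP plaquette cut-off of record: `chiPlaq δ p U = 𝟙[dist1 (U(∂p)) < δ]` (the characteristic function of the
small-field condition at ONE plaquette; `Setup.PlaqSmall δ` is the conjunction over all plaquettes). [folklore] -/
def chiPlaq (δ : ℝ) (p : Plaq P j) (U : GaugeField P j G) : ℝ :=
  if dist1 (GaugeField.plaqHol U p) < δ then 1 else 0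

/-- `chiPlaq ∈ {0, 1}`: value `1` iff the plaquette is small. [folklore] -/
theorem chiPlaq_eq_one_iff (δ : ℝ) (p : Plaq P j) (U : GaugeField P j G) :
    chiPlaq δ p U = 1 ↔ dist1 (GaugeField.plaqHol U p) < δ := by
  unfold chiPlaq; split_ifs with h <;> simp [h]

/-- `chiPlaq = 0` iff the plaquette is large. [folklore] -/
theorem chiPlaq_eq_zero_iff (δ : ℝ) (p : Plaq P j) (U : GaugeField P j G) :
    chiPlaq δ p U = 0 ↔ δ ≤ dist1 (GaugeField.plaqHol U p) := by
  unfold chiPlaq; split_ifs with h <;> simp [h, not_le.mpr, le_of_not_gt]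

/-- `0 ≤ chiPlaq ≤ 1`. [folklore] -/
theorem chiPlaq_nonneg_le_one (δ : ℝ) (p : Plaq P j) (U : GaugeField P j G) :
    0 ≤ chiPlaq δ p U ∧ chiPlaq δ p U ≤ 1 := by
  unfold chiPlaq; split_ifs <;> norm_num

/-- Idempotence `χ·χ = χ`. [folklore] -/
theorem chiPlaq_mul_self (δ : ℝ) (p : Plaq P j) (U : GaugeField P j G) :
    chiPlaq δ p U * chiPlaq δ p U = chiPlaq δ p U := by
  unfold chiPlaq; split_ifs <;> norm_num

/-- Complementarity `χ·(1 − χ) = 0`. [folklore] -/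
theorem chiPlaq_mul_one_sub (δ : ℝ) (p : Plaq P j) (U : GaugeField P j G) :
    chiPlaq δ p U * (1 - chiPlaq δ p U) = 0 := by
  unfold chiPlaq; split_ifs <;> norm_num

/-- **THE PRODUCT OF THE SHARP CUT-OFFS OVER A PLAQUETTE SET IS THE TREE's `chiSmall`**:
`Π_{p ∈ S} chiPlaq δ p U = Setup.chiSmall ↑S δ U`. [folklore] -/
theorem prod_chiPlaq (S : Finset (Plaq P j)) (δ : ℝ) (U : GaugeField P j G) :
    ∏ p ∈ S, chiPlaq δ p U = chiSmall (↑S : Set (Plaq P j)) δ U := by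
  classical
  unfold chiSmall PlaqSmallOn
  split_ifs with h
  · refine Finset.prod_eq_one fun p hp => ?_
    exact (chiPlaq_eq_one_iff δ p U).mpr (h p (Finset.mem_coe.mpr hp))
  · push Not at h
    obtain ⟨p, hp, hle⟩ := h
    exact Finset.prod_eq_zero (Finset.mem_coe.mp hp) ((chiPlaq_eq_zero_iff δ p U).mpr hle)

/-- … over ALL plaquettes: `Π_p chiPlaq δ p U = Setup.chiSmall Set.univ δ U` (`= 𝟙[Setup.PlaqSmall δ U]`). [folklore] -/
theorem prod_chiPlaq_univ (δ : ℝ) (U : GaugeField P j G) :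
    ∏ p : Plaq P j, chiPlaq δ p U = chiSmall (Set.univ : Set (Plaq P j)) δ U := by
  rw [← Finset.coe_univ]; exact prod_chiPlaq Finset.univ δ U

/-- `chiSmall Set.univ δ U = 1 ↔ PlaqSmall δ U` (reading of the tree's classical `if`). [folklore] -/
theorem chiSmall_univ_eq_one_iff (δ : ℝ) (U : GaugeField P j G) :
    chiSmall (Set.univ : Set (Plaq P j)) δ U = 1 ↔ PlaqSmall δ U := by
  classical
  unfold chiSmall
  have e : PlaqSmallOn (Set.univ : Set (Plaq P j)) δ U ↔ PlaqSmall δ U :=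
    ⟨fun h p => h p (Set.mem_univ p), fun h p _ => h p⟩
  split_ifs with h
  · simp [e.mp h]
  · simp only [zero_ne_one, false_iff]
    exact fun h' => h (e.mpr h')

/-- THE LARGE-FIELD SET OF A CONFIGURATION at threshold `δ`: the plaquettes with `δ ≤ dist1 (V(∂p))`. [folklore] -/
def largeSet (δ : ℝ) (V : GaugeField P j G) : Finset (Plaq P j) :=
  Finset.univ.filter fun p => δ ≤ dist1 (GaugeField.plaqHol V p)

/-- Membership in the large-field set. [folklore] -/
theorem mem_largeSet (δ : ℝ) (V : GaugeField P j G) (p : Plaq P j) :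
    p ∈ largeSet δ V ↔ δ ≤ dist1 (GaugeField.plaqHol V p) := by
  simp [largeSet]

/-- The large-field set is empty iff the configuration is small everywhere. [folklore] -/
theorem largeSet_eq_empty_iff (δ : ℝ) (V : GaugeField P j G) : largeSet δ V = ∅ ↔ PlaqSmall δ V := by
  simp only [Finset.eq_empty_iff_forall_notMem, mem_largeSet, not_le]
  rfl

section Sharp
variable [DecidableEq (Plaq P j)]

/-- **EXACT READING OF THE SHARP DECOMPOSITION**: with the sharp cut-offs the piece of region `Z` is `ρ(V)` if `Z` IS the
large-field set of `V`, and `0` otherwise — «the sum over `Z`» selects THE large-field set of the configuration (cube version: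
`B14Sect1Sets.decompUnity_term_eq_one_iff`). [folklore] -/
theorem lfPiece_chiPlaq (δ : ℝ) (ρ : Density P j G) (Z : Finset (Plaq P j)) (V : GaugeField P j G) :
    lfPiece (chiPlaq δ) ρ Z V = if Z = largeSet δ V then ρ V else 0 := by
  rw [lfPiece_apply]
  split_ifs with hZ
  · -- every factor is `1`
    have h1 : ∏ p ∈ Z, (1 - chiPlaq δ p V) = 1 := by
      refine Finset.prod_eq_one fun p hp => ?_
      have : chiPlaq δ p V = 0 := (chiPlaq_eq_zero_iff δ p V).mpr ((mem_largeSet δ V p).mp (hZ ▸ hp))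
      rw [this, sub_zero]
    have h2 : ∏ p ∈ Zᶜ, chiPlaq δ p V = 1 := by
      refine Finset.prod_eq_one fun p hp => ?_
      rw [Finset.mem_compl, hZ, mem_largeSet, not_le] at hp
      exact (chiPlaq_eq_one_iff δ p V).mpr hp
    rw [h1, h2, mul_one, mul_one]
  · -- some factor vanishes: a plaquette on which `Z` and `largeSet δ V` disagree
    have : ∃ p, ¬ (p ∈ Z ↔ p ∈ largeSet δ V) := by
      by_contra hall
      push Not at hall
      exact hZ (Finset.ext hall)
    obtain ⟨p, hp⟩ := this
    by_cases hpZ : p ∈ Z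
    · -- `p ∈ Z` but small: the factor `1 − χ_p` vanishes
      have hsmall : dist1 (GaugeField.plaqHol V p) < δ := by
        have : p ∉ largeSet δ V := fun h => hp ⟨fun _ => h, fun _ => hpZ⟩
        rwa [mem_largeSet, not_le] at this
      have h0 : ∏ q ∈ Z, (1 - chiPlaq δ q V) = 0 :=
        Finset.prod_eq_zero hpZ (by rw [(chiPlaq_eq_one_iff δ p V).mpr hsmall, sub_self])
      rw [h0, mul_zero, zero_mul]
    · -- `p ∉ Z` but large: the factor `χ_p` vanishes
      have hlarge : δ ≤ dist1 (GaugeField.plaqHol V p) := by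
        have : p ∈ largeSet δ V := by
          by_contra h
          exact hp ⟨fun h' => absurd h' hpZ, fun h' => absurd h' h⟩
        exact (mem_largeSet δ V p).mp this
      have h0 : ∏ q ∈ Zᶜ, chiPlaq δ q V = 0 :=
        Finset.prod_eq_zero (Finset.mem_compl.mpr hpZ) ((chiPlaq_eq_zero_iff δ p V).mpr hlarge)
      rw [h0, mul_zero]

/-- In particular the sharp small-field piece is `ρ · 𝟙[PlaqSmall δ]` (`= ρ · chiSmall univ δ`). [folklore] -/
theorem lfPiece_chiPlaq_empty (δ : ℝ) (ρ : Density P j G) (V : GaugeField P j G) :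
    lfPiece (chiPlaq δ) ρ ∅ V = ρ V * chiSmall (Set.univ : Set (Plaq P j)) δ V := by
  rw [lfPiece_empty, prod_chiPlaq_univ]

/-- The sharp decomposition of record (regions = plaquette sets, pieces `ρ · 𝟙[Z = largeSet δ V]`) for a non-negative
density. [folklore] -/
def lfDecompSharp (δ : ℝ) (ρ : Density P j G) (hρ : ∀ V, 0 ≤ ρ V) : LargeFieldDecomp P j G :=
  lfDecompStd (chiPlaq δ) ρ (fun p V => chiPlaq_nonneg_le_one δ p V) hρ

/-- Its total is `ρ`. [folklore] -/
theorem lfDecompSharp_total (δ : ℝ) (ρ : Density P j G) (hρ : ∀ V, 0 ≤ ρ V) : (lfDecompSharp δ ρ hρ).total = ρ :=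
  lfDecompStd_total _ ρ _ hρ

/-- Its pieces, read exactly. [folklore] -/
theorem lfDecompSharp_piece (δ : ℝ) (ρ : Density P j G) (hρ : ∀ V, 0 ≤ ρ V) (Z : Finset (Plaq P j))
    (V : GaugeField P j G) : (lfDecompSharp δ ρ hρ).piece Z V = if Z = largeSet δ V then ρ V else 0 :=
  lfPiece_chiPlaq δ ρ Z V

end Sharp

end SharpCutoff

/-! ## §4 Measurability (so that the pieces integrate against `Setup.fieldMeasure`) -/

section Measurability
variable [MeasurableSpace G]

section Holonomy
variable [GaugeGroup G] [MeasurableMul₂ G] [MeasurableInv G]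

/-- The plaquette holonomy `U ↦ U(∂p)` is measurable (evaluations, products, inverses). [folklore] -/
theorem measurable_plaqHol (p : Plaq P j) : Measurable fun U : GaugeField P j G => GaugeField.plaqHol U p := by
  unfold GaugeField.plaqHol
  have hev : ∀ b : PBond P j, Measurable fun U : GaugeField P j G => U b := fun b => measurable_pi_apply b
  exact (((hev _).mul (hev _)).mul (hev _).inv).mul (hev _).inv

/-- The sharp cut-off is measurable, given a measurable `dist1` (displayed: `GaugeGroup` carries no measurable structure on
`dist1`). [folklore] -/
theorem measurable_chiPlaq (hd : Measurable (dist1 : G → ℝ)) (δ : ℝ) (p : Plaq P j) :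
    Measurable fun U : GaugeField P j G => chiPlaq δ p U := by
  unfold chiPlaq
  refine Measurable.ite ?_ measurable_const measurable_const
  exact measurableSet_lt (hd.comp (measurable_plaqHol p)) measurable_const

end Holonomy

/-- The pieces are measurable for measurable weights and density. [folklore] -/
theorem measurable_lfPiece [DecidableEq (Plaq P j)] {χ : Plaq P j → GaugeField P j G → ℝ} {ρ : Density P j G}
    (hχ : ∀ p, Measurable (χ p)) (hρ : Measurable ρ) (Z : Finset (Plaq P j)) : Measurable (lfPiece χ ρ Z) := by
  unfold lfPiece
  refine (hρ.mul (Finset.measurable_prod _ fun p _ => ?_)).mul (Finset.measurable_prod _ fun p _ => hχ p)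
  exact measurable_const.sub (hχ p)

/-- The sharp pieces are measurable for a measurable density and `dist1`. [folklore] -/
theorem measurable_lfPiece_chiPlaq [GaugeGroup G] [MeasurableMul₂ G] [MeasurableInv G] [DecidableEq (Plaq P j)] (hd : Measurable (dist1 : G → ℝ)) {ρ : Density P j G}
    (hρ : Measurable ρ) (δ : ℝ) (Z : Finset (Plaq P j)) : Measurable (lfPiece (chiPlaq δ) ρ Z) :=
  measurable_lfPiece (fun p => measurable_chiPlaq hd δ p) hρ Z

end Measurability

end Summit.QuantumFields.BalabanUV.T4Continuum.SubstrateLargeField
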